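import Summits.ABC.IUTFork.LDHSplitPlaceArithmetic
import Literature.IUT.LogVolume.Corollary22TwoAdicIntegrality
import Literature.IUT.LogVolume.FakeAdeleIndexLocalDegree
import Literature.IUT.LogVolume.PilotSlotResidue
import Mathlib.FieldTheory.KummerPolynomial
import HarnessLib

/-!
# The S-unit quadratic family of the `λ`-line: I. The fields `F_{a,c} = ℚ(√(5^{2a} + 4·7^{2c}))`, the
# integers `θ, θ'` with `θ + θ' = 2·7^c + 5^a`, `θ·θ' = 5^a·7^c`, and the SPLIT places over `5` and `7`

Record-only PROOF file (D-0012) of the abc-iut cell (R2 S-chain team, seat abc-iut-s2-p4 gen 4); TAKES NO SIDE on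
[IUTchIII] Cor. 3.12 or [IUTchIV] Thm. 1.10. S. Mochizuki, *Arithmetic elliptic curves in general position*
[MochizukiGenEll2010], Ex. 1.3 (ii) p. 5 (compactly bounded subsets), Def. 1.5 p. 8; *IUT IV* [Mochizuki2012], Cor. 2.2
(ii) proof (P1)–(P7) pp. 45–46; Dupuy–Hilado [DupuyHilado2025] §3.6 (weights `Pr(v) = n_v/[F:ℚ]`).

WHY. The (U)-line CONE binder `hvol`/`hreg` of the branch-C certificates is refuted as a `∀`-binder as soon as ONE compactly
bounded `K_V` carries admissible points above every height whose mixed bad height exceeds the sharp slack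
(abc-iut-s2-p1's `PointDict.not_hvol_of_frequently_highMixedPoint`). Certifying (P2) (`l ∤ ord_V j(λ)` at EVERY pole
`V`) at a FIXED prime `l` for points of unbounded height needs points whose `j`-pole divisor is COMPLETELY known. This is
possible exactly when `λ` and `1 − λ` are both `S`-units for a fixed finite `S`; by the `S`-unit theorem the field must then
vary. THIS FILE builds the simplest such family: for `a, c ≥ 1` let `s := 2·7^c + 5^a`, `D := s² − 4·5^a·7^c =
5^{2a} + 4·7^{2c}` (`≡ 2 (mod 3)`, never a square), `F := ℚ(δ)`, `δ² = D`, `θ := (s + δ)/2`, `θ' := (s − δ)/2` (algebraic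
integers, roots of `X² − sX + 5^a7^c`), and later `λ := θ/7^c` (part II). Here: the field, its conjugation `σ`, `θ, θ'`,
and the two places over each of `5` and `7` separated by `θ, θ'` (`θ ∈ 𝔭₁ ∌ θ'`, `θ' ∈ 𝔭₂ ∌ θ`), with `Pr = 1/2`, `n = 1`,
`log N = log p` (abc-iut-s2-p3's `SplitDepth.weight_eq_half_and_logNorm_eq`) and `V(F)_p = {𝔭₁, 𝔭₂}`.
Technique adapted from abc-iut-s2-p5's `LambdaLineQuadraticWitness` (conjugate place). Nothing asserted about Θ-data; no side taken.
[cite: MochizukiGenEll2010, Ex 1.3 (ii) p.5] [cite: DupuyHilado2025, §3.6] [cite: NeukirchANT1999, Ch. I §8]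
-/

noncomputable section

namespace Summit.ABC.IUTFork.SUnitFamily

open NumberField IsDedekindDomain Polynomial Literature.IUT.LogVolume
open Literature.NumberTheory.DiophantineGeometry.GenEll

/-! ## The discriminant `D = 5^{2a} + 4·7^{2c}` is not a square -/

/-- `D(a,c) := 5^{2a} + 4·7^{2c}` (the discriminant of `X² − (2·7^c + 5^a)X + 5^a·7^c`). [cite: MochizukiGenEll2010, Ex 1.3 (ii) p.5] -/
def D (a c : ℕ) : ℕ := 5 ^ (2 * a) + 4 * 7 ^ (2 * c)

/-- `s(a,c) := 2·7^c + 5^a` (the trace `θ + θ'`). [cite: MochizukiGenEll2010, Ex 1.3 (ii) p.5] -/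
def s (a c : ℕ) : ℕ := 2 * 7 ^ c + 5 ^ a

/-- `s² = D + 4·5^a·7^c`. [folklore] -/
theorem s_sq (a c : ℕ) : s a c ^ 2 = D a c + 4 * (5 ^ a * 7 ^ c) := by
  unfold s D; ring

/-- `D ≡ 2 (mod 3)`. [folklore] -/
theorem D_cast_zmod_three (a c : ℕ) : (D a c : ZMod 3) = 2 := by
  unfold D
  push_cast
  have h5 : (5 : ZMod 3) ^ 2 = 1 := by decide
  have h7 : (7 : ZMod 3) ^ 2 = 1 := by decide
  rw [pow_mul, h5, one_pow, pow_mul, h7, one_pow]; decide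

/-- `D` is not a perfect square (squares are `0, 1 (mod 3)`). [folklore] -/
theorem not_isSquare_D (a c : ℕ) : ¬ IsSquare (D a c) := by
  rintro ⟨t, ht⟩
  have h := D_cast_zmod_three a c
  rw [ht, Nat.cast_mul] at h
  have : ∀ x : ZMod 3, x * x ≠ 2 := by decide
  exact this _ h

/-- `D` is not a square in `ℚ`. [folklore] -/
theorem not_isSquare_D_rat (a c : ℕ) : ¬ IsSquare ((D a c : ℕ) : ℚ) := by
  rw [Rat.isSquare_natCast_iff]; exact not_isSquare_D a c

/-! ## The field `F_{a,c} = ℚ(√D)` -/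

/-- The defining polynomial `X² − D`. [cite: MochizukiGenEll2010, Ex 1.3 (ii) p.5] -/
def fpoly (a c : ℕ) : ℚ[X] := X ^ 2 - C ((D a c : ℕ) : ℚ)

/-- `X² − D` is irreducible over `ℚ`. [folklore] -/
theorem irreducible_fpoly (a c : ℕ) : Irreducible (fpoly a c) := by
  refine X_pow_sub_C_irreducible_of_prime Nat.prime_two fun b hb => ?_
  exact not_isSquare_D_rat a c ⟨b, by rw [← hb]; ring⟩

/-- The number field `F_{a,c} = ℚ[X]/(X² − D)`. [cite: MochizukiGenEll2010, Ex 1.3 (ii) p.5] -/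
abbrev F (a c : ℕ) : Type := AdjoinRoot (fpoly a c)

/-- (instance plumbing) irreducibility as a `Fact`, so that `F` is a field. [folklore] -/
instance fact_irreducible_fpoly (a c : ℕ) : Fact (Irreducible (fpoly a c)) := ⟨irreducible_fpoly a c⟩

/-- `X² − D ≠ 0`. [folklore] -/
theorem fpoly_ne_zero (a c : ℕ) : fpoly a c ≠ 0 := (irreducible_fpoly a c).ne_zero

/-- (instance plumbing) characteristic zero. [folklore] -/
instance charZero_F (a c : ℕ) : CharZero (F a c) := charZero_of_injective_algebraMap (algebraMap ℚ (F a c)).injective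

/-- (instance plumbing) finite-dimensional over `ℚ`. [folklore] -/
instance finiteDimensional_F (a c : ℕ) : FiniteDimensional ℚ (F a c) := (AdjoinRoot.powerBasis (fpoly_ne_zero a c)).finite

/-- (instance plumbing) `F` is a number field. [folklore] -/
instance numberField_F (a c : ℕ) : NumberField (F a c) := NumberField.mk

/-- `[F : ℚ] = 2`. [folklore] -/
theorem finrank_F (a c : ℕ) : Module.finrank ℚ (F a c) = 2 := by
  rw [(AdjoinRoot.powerBasis (fpoly_ne_zero a c)).finrank, AdjoinRoot.powerBasis_dim]
  show (X ^ 2 - C ((D a c : ℕ) : ℚ)).natDegree = 2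
  rw [natDegree_X_pow_sub_C]

/-- `fpoly` evaluates as `x² − D`. [folklore] -/
theorem eval₂_fpoly (a c : ℕ) {S : Type*} [CommRing S] (i : ℚ →+* S) (x : S) :
    eval₂ i x (fpoly a c) = x ^ 2 - (D a c : S) := by
  show eval₂ i x (X ^ 2 - C ((D a c : ℕ) : ℚ)) = _
  simp [eval₂_sub, eval₂_X_pow]

variable {a c : ℕ}

/-- `δ = √D ∈ F`. [cite: MochizukiGenEll2010, Ex 1.3 (ii) p.5] -/
def δ (a c : ℕ) : F a c := AdjoinRoot.root (fpoly a c)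

/-- `δ² = D`. [folklore] -/
theorem δ_sq (a c : ℕ) : δ a c ^ 2 = (D a c : F a c) := by
  have h := AdjoinRoot.eval₂_root (fpoly a c)
  rw [eval₂_fpoly] at h
  exact sub_eq_zero.mp h

/-- `δ ≠ 0`. [folklore] -/
theorem δ_ne_zero (a c : ℕ) : δ a c ≠ 0 := by
  intro h
  have := δ_sq a c
  rw [h, zero_pow two_ne_zero] at this
  have : (D a c : F a c) = 0 := this.symm
  exact absurd (by exact_mod_cast this : D a c = 0) (by unfold D; positivity)

/-- The conjugation `σ : δ ↦ −δ`. [folklore] -/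
def σ (a c : ℕ) : F a c →ₐ[ℚ] F a c :=
  AdjoinRoot.liftAlgHom (fpoly a c) (Algebra.ofId ℚ (F a c)) (-δ a c) (by rw [eval₂_fpoly, neg_sq, δ_sq, sub_self])

/-- `σ δ = −δ`. [folklore] -/
theorem σ_δ (a c : ℕ) : σ a c (δ a c) = -δ a c :=
  AdjoinRoot.liftAlgHom_root _ _ _ _

/-- `σ ∘ σ = id`. [folklore] -/
theorem σ_σ (x : F a c) : σ a c (σ a c x) = x := by
  have h : (σ a c).comp (σ a c) = AlgHom.id ℚ (F a c) := by
    refine AdjoinRoot.algHom_ext ?_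
    change σ a c (σ a c (δ a c)) = δ a c
    rw [σ_δ, map_neg, σ_δ, neg_neg]
  exact congrArg (fun φ : F a c →ₐ[ℚ] F a c => φ x) h

/-! ## The algebraic integers `θ = (s + δ)/2`, `θ' = (s − δ)/2` -/

/-- `θ := (s + δ)/2`. [cite: MochizukiGenEll2010, Ex 1.3 (ii) p.5] -/
def θ (a c : ℕ) : F a c := ((s a c : F a c) + δ a c) / 2

/-- `θ' := (s − δ)/2`. [cite: MochizukiGenEll2010, Ex 1.3 (ii) p.5] -/
def θ' (a c : ℕ) : F a c := ((s a c : F a c) - δ a c) / 2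

/-- `θ + θ' = s`. [folklore] -/
theorem θ_add_θ' (a c : ℕ) : θ a c + θ' a c = (s a c : F a c) := by
  unfold θ θ'; ring

/-- `θ·θ' = 5^a·7^c`. [folklore] -/
theorem θ_mul_θ' (a c : ℕ) : θ a c * θ' a c = ((5 ^ a * 7 ^ c : ℕ) : F a c) := by
  have h1 : θ a c * θ' a c = ((s a c : F a c) ^ 2 - δ a c ^ 2) / 4 := by unfold θ θ'; ring
  have h2 : ((s a c : F a c)) ^ 2 = (D a c : F a c) + 4 * ((5 ^ a * 7 ^ c : ℕ) : F a c) := by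
    have := s_sq a c
    exact_mod_cast congrArg (fun n : ℕ => (n : F a c)) this
  rw [h1, δ_sq, h2]; ring

/-- `θ − θ' = δ`. [folklore] -/
theorem θ_sub_θ' (a c : ℕ) : θ a c - θ' a c = δ a c := by
  unfold θ θ'; ring

/-- `σ θ = θ'`. [folklore] -/
theorem σ_θ (a c : ℕ) : σ a c (θ a c) = θ' a c := by
  unfold θ θ'
  rw [map_div₀, map_add, σ_δ, map_natCast, map_ofNat]; ring

/-- `σ θ' = θ`. [folklore] -/
theorem σ_θ' (a c : ℕ) : σ a c (θ' a c) = θ a c := by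
  rw [← σ_θ, σ_σ]

/-- `θ` is a root of the monic integer polynomial `X² − sX + 5^a7^c`. [folklore] -/
theorem θ_sq_sub (a c : ℕ) : θ a c ^ 2 - (s a c : F a c) * θ a c + ((5 ^ a * 7 ^ c : ℕ) : F a c) = 0 := by
  rw [← θ_mul_θ', ← θ_add_θ']; ring

/-- `θ'` is a root of `X² − sX + 5^a7^c`. [folklore] -/
theorem θ'_sq_sub (a c : ℕ) : θ' a c ^ 2 - (s a c : F a c) * θ' a c + ((5 ^ a * 7 ^ c : ℕ) : F a c) = 0 := by
  rw [← θ_mul_θ', ← θ_add_θ']; ring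

/-- `θ'` is an algebraic integer. [folklore] -/
theorem isIntegral_θ' (a c : ℕ) : IsIntegral ℤ (θ' a c) := by
  refine ⟨X ^ 2 - C (s a c : ℤ) * X + C ((5 ^ a * 7 ^ c : ℕ) : ℤ), by monicity!, ?_⟩
  have h := θ'_sq_sub a c
  simp only [eval₂_sub, eval₂_add, eval₂_mul, eval₂_pow, eval₂_X, eval₂_natCast, eval₂_ofNat,
    map_natCast, map_mul, map_pow, map_ofNat, Nat.cast_mul, Nat.cast_pow, Nat.cast_ofNat] at h ⊢
  linear_combination h

/-- `θ` is an algebraic integer. [folklore] -/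
theorem isIntegral_θ (a c : ℕ) : IsIntegral ℤ (θ a c) := by
  refine ⟨X ^ 2 - C (s a c : ℤ) * X + C ((5 ^ a * 7 ^ c : ℕ) : ℤ), by monicity!, ?_⟩
  have h := θ_sq_sub a c
  simp only [eval₂_sub, eval₂_add, eval₂_mul, eval₂_pow, eval₂_X, eval₂_natCast, eval₂_ofNat,
    map_natCast, map_mul, map_pow, map_ofNat, Nat.cast_mul, Nat.cast_pow, Nat.cast_ofNat] at h ⊢
  linear_combination h

/-! ## `θ, θ'` as elements of `𝓞 F`; the conjugation on `𝓞 F` and on places -/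

/-- `θ ∈ 𝓞 F`. [folklore] -/
def θI (a c : ℕ) : 𝓞 (F a c) := ⟨θ a c, isIntegral_θ a c⟩

/-- `θ' ∈ 𝓞 F`. [folklore] -/
def θI' (a c : ℕ) : 𝓞 (F a c) := ⟨θ' a c, isIntegral_θ' a c⟩

/-- Coercion of `θI`. [folklore] -/
@[simp] theorem coe_θI (a c : ℕ) : ((θI a c : 𝓞 (F a c)) : F a c) = θ a c := rfl

/-- Coercion of `θI'`. [folklore] -/
@[simp] theorem coe_θI' (a c : ℕ) : ((θI' a c : 𝓞 (F a c)) : F a c) = θ' a c := rfl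

/-- `θ + θ' = s` in `𝓞 F`. [folklore] -/
theorem θI_add_θI' (a c : ℕ) : θI a c + θI' a c = ((s a c : ℕ) : 𝓞 (F a c)) := by
  apply RingOfIntegers.coe_injective; push_cast; exact θ_add_θ' a c

/-- `θ·θ' = 5^a·7^c` in `𝓞 F`. [folklore] -/
theorem θI_mul_θI' (a c : ℕ) : θI a c * θI' a c = ((5 ^ a * 7 ^ c : ℕ) : 𝓞 (F a c)) := by
  apply RingOfIntegers.coe_injective; push_cast
  have := θ_mul_θ' a c; push_cast at this; exact this

/-- The conjugation on `𝓞 F`. [folklore] -/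
def σI (a c : ℕ) : 𝓞 (F a c) →+* 𝓞 (F a c) := RingOfIntegers.mapRingHom (σ a c : F a c →+* F a c)

/-- `σI ∘ σI = id`. [folklore] -/
theorem σI_σI (x : 𝓞 (F a c)) : σI a c (σI a c x) = x := by
  apply RingOfIntegers.coe_injective; change σ a c (σ a c (x : F a c)) = (x : F a c); exact σ_σ _

/-- `σI θ = θ'`. [folklore] -/
theorem σI_θI (a c : ℕ) : σI a c (θI a c) = θI' a c := by
  apply RingOfIntegers.coe_injective; change σ a c (θ a c) = θ' a c; exact σ_θ a c

/-- `σI θ' = θ`. [folklore] -/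
theorem σI_θI' (a c : ℕ) : σI a c (θI' a c) = θI a c := by
  rw [← σI_θI, σI_σI]

/-- The conjugate place `σ⁻¹(v)` (pull-back of `v` along `σI`). [cite: NeukirchANT1999, Ch. I §8] -/
def conjPlace (v : HeightOneSpectrum (𝓞 (F a c))) : HeightOneSpectrum (𝓞 (F a c)) :=
  ⟨v.asIdeal.comap (σI a c), Ideal.IsPrime.comap (σI a c), fun h => by
    obtain ⟨x, hx, hx0⟩ := v.asIdeal.ne_bot_iff.mp v.ne_bot
    have hmem : σI a c x ∈ v.asIdeal.comap (σI a c) := by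
      rw [Ideal.mem_comap, σI_σI]; exact hx
    rw [h, Ideal.mem_bot] at hmem
    apply hx0
    rw [← σI_σI x, hmem, map_zero]⟩

/-- Membership in the conjugate place. [cite: NeukirchANT1999, Ch. I §8] -/
theorem mem_conjPlace {v : HeightOneSpectrum (𝓞 (F a c))} {x : 𝓞 (F a c)} :
    x ∈ (conjPlace v).asIdeal ↔ σI a c x ∈ v.asIdeal := Ideal.mem_comap

/-- A natural number lies in `σ⁻¹(v)` iff it lies in `v`. [cite: NeukirchANT1999, Ch. I §8] -/
theorem natCast_mem_conjPlace {v : HeightOneSpectrum (𝓞 (F a c))} {n : ℕ} :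
    ((n : ℕ) : 𝓞 (F a c)) ∈ (conjPlace v).asIdeal ↔ ((n : ℕ) : 𝓞 (F a c)) ∈ v.asIdeal := by
  rw [mem_conjPlace, map_natCast]

/-! ## The two places over a prime `p ∈ {5, 7}` separated by `θ, θ'` -/

section Places

variable (a c : ℕ) {p : ℕ} [hp : Fact p.Prime]

/-- If `p ∣ 5^a·7^c` and `p ∤ s`, a place `v ∋ θ` over `p` gives the separating pair `(v, σ⁻¹v)`:
`θ ∈ v`, `θ' ∈ σ⁻¹v`, `θ ∉ σ⁻¹v`, `θ' ∉ v`. [cite: NeukirchANT1999, Ch. I §8] -/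
theorem places_of_mem {v : HeightOneSpectrum (𝓞 (F a c))} (hpv : ((p : ℕ) : 𝓞 (F a c)) ∈ v.asIdeal)
    (hps : ¬ p ∣ s a c) (hθ : θI a c ∈ v.asIdeal) :
    θI a c ∈ v.asIdeal ∧ θI' a c ∈ (conjPlace v).asIdeal ∧ θI a c ∉ (conjPlace v).asIdeal ∧ θI' a c ∉ v.asIdeal ∧
      ((p : ℕ) : 𝓞 (F a c)) ∈ v.asIdeal ∧ ((p : ℕ) : 𝓞 (F a c)) ∈ (conjPlace v).asIdeal := by
  have hv : v ∈ placesOver (F a c) p := Cor22.mem_placesOver_of_natCast_mem p v hpv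
  have hs : ((s a c : ℕ) : 𝓞 (F a c)) ∉ v.asIdeal := by
    rw [SplitDepth.natCast_mem_asIdeal_iff ⟨v, hv⟩]; exact hps
  have hθ' : θI' a c ∉ v.asIdeal := fun h => hs (θI_add_θI' a c ▸ v.asIdeal.add_mem hθ h)
  refine ⟨hθ, mem_conjPlace.mpr (by rw [σI_θI']; exact hθ), fun h => hθ' ?_, hθ', hpv, natCast_mem_conjPlace.mpr hpv⟩
  rw [mem_conjPlace, σI_θI] at h
  exact h

/-- **The two places over `p`**, for a prime `p ∣ 5^a·7^c` with `p ∤ s = 2·7^c + 5^a`: `𝔭₁ ∋ θ`, `𝔭₂ ∋ θ'`, `θ ∉ 𝔭₂`, `θ' ∉ 𝔭₁`.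
[cite: NeukirchANT1999, Ch. I §8] -/
theorem exists_places (hdvd : p ∣ 5 ^ a * 7 ^ c) (hps : ¬ p ∣ s a c) :
    ∃ 𝔭₁ 𝔭₂ : HeightOneSpectrum (𝓞 (F a c)),
      θI a c ∈ 𝔭₁.asIdeal ∧ θI' a c ∈ 𝔭₂.asIdeal ∧ θI a c ∉ 𝔭₂.asIdeal ∧ θI' a c ∉ 𝔭₁.asIdeal ∧
        ((p : ℕ) : 𝓞 (F a c)) ∈ 𝔭₁.asIdeal ∧ ((p : ℕ) : 𝓞 (F a c)) ∈ 𝔭₂.asIdeal := by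
  obtain ⟨v, hv⟩ := placesOver_nonempty (F a c) p
  have hpv : ((p : ℕ) : 𝓞 (F a c)) ∈ v.asIdeal := by
    have h := natCast_residueChar_mem (F a c) v
    rwa [(mem_placesOver_iff_residueChar v).mp hv] at h
  have hprod : θI a c * θI' a c ∈ v.asIdeal := by
    rw [θI_mul_θI']
    exact (SplitDepth.natCast_mem_asIdeal_iff ⟨v, hv⟩ _).mpr hdvd
  rcases v.isPrime.mem_or_mem hprod with h | h
  · exact ⟨v, conjPlace v, places_of_mem a c hpv hps h⟩
  · have h' : θI a c ∈ (conjPlace v).asIdeal := mem_conjPlace.mpr (by rw [σI_θI]; exact h)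
    obtain ⟨h1, h2, h3, h4, h5, h6⟩ := places_of_mem a c (natCast_mem_conjPlace.mpr hpv) hps h'
    exact ⟨conjPlace v, conjPlace (conjPlace v), h1, h2, h3, h4, h5, h6⟩

end Places

/-! ## The separating pair: distinctness, `V(F)_p = {𝔭₁, 𝔭₂}`, weights -/

section Pair

variable {a c : ℕ} {p : ℕ} [hp : Fact p.Prime] {𝔭₁ 𝔭₂ : HeightOneSpectrum (𝓞 (F a c))}
  (h₁ : θI a c ∈ 𝔭₁.asIdeal) (h₂' : θI a c ∉ 𝔭₂.asIdeal)
  (hp₁ : ((p : ℕ) : 𝓞 (F a c)) ∈ 𝔭₁.asIdeal) (hp₂ : ((p : ℕ) : 𝓞 (F a c)) ∈ 𝔭₂.asIdeal)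
include h₁ h₂'

/-- `𝔭₁ ≠ 𝔭₂`. [cite: NeukirchANT1999, Ch. I §8] -/
theorem ne_of_sep : 𝔭₂ ≠ 𝔭₁ := fun h => h₂' (h ▸ h₁)

include hp₁ hp₂

open scoped Classical in
/-- `V(F)_p = {𝔭₁, 𝔭₂}` (`[F:ℚ] = 2` places at most over `p`). [cite: NeukirchANT1999, Ch. I §8] -/
theorem placesOver_eq_pair : placesOver (F a c) p = {𝔭₁, 𝔭₂} := by
  have hv₁ : 𝔭₁ ∈ placesOver (F a c) p := Cor22.mem_placesOver_of_natCast_mem p 𝔭₁ hp₁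
  have hv₂ : 𝔭₂ ∈ placesOver (F a c) p := Cor22.mem_placesOver_of_natCast_mem p 𝔭₂ hp₂
  have hsub : ({𝔭₁, 𝔭₂} : Finset _) ⊆ placesOver (F a c) p := by
    intro v hv
    simp only [Finset.mem_insert, Finset.mem_singleton] at hv
    rcases hv with rfl | rfl
    · exact hv₁
    · exact hv₂
  have hcard : (placesOver (F a c) p).card ≤ ({𝔭₁, 𝔭₂} : Finset _).card := by
    rw [Finset.card_pair (ne_of_sep h₁ h₂').symm, ← finrank_F a c]
    exact PilotData.card_placesOver_le_finrank (F := F a c) p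
  exact (Finset.eq_of_subset_of_card_le hsub hcard).symm

/-- `n_{𝔭₁} = n_{𝔭₂} = 1`. [cite: DupuyHilado2025, §3.6] -/
theorem localDegree_pair_eq_one : localDegree (F a c) 𝔭₁ = 1 ∧ localDegree (F a c) 𝔭₂ = 1 :=
  SplitDepth.localDegree_eq_one (finrank_F a c) ⟨𝔭₁, Cor22.mem_placesOver_of_natCast_mem p 𝔭₁ hp₁⟩
    ⟨𝔭₂, Cor22.mem_placesOver_of_natCast_mem p 𝔭₂ hp₂⟩ (Subtype.coe_injective.ne_iff.mp (ne_of_sep h₁ h₂'))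

/-- `Pr(𝔭₁) = Pr(𝔭₂) = 1/2` and `log N(𝔭₁) = log N(𝔭₂) = log p`. [cite: DupuyHilado2025, §3.6] -/
theorem weight_pair_eq_half :
    (weight (F a c) 𝔭₁ = 1 / 2 ∧ logNorm (F a c) 𝔭₁ = Real.log p) ∧
      (weight (F a c) 𝔭₂ = 1 / 2 ∧ logNorm (F a c) 𝔭₂ = Real.log p) :=
  ⟨SplitDepth.weight_eq_half_and_logNorm_eq (finrank_F a c) ⟨𝔭₁, Cor22.mem_placesOver_of_natCast_mem p 𝔭₁ hp₁⟩
    ⟨𝔭₂, Cor22.mem_placesOver_of_natCast_mem p 𝔭₂ hp₂⟩ (Subtype.coe_injective.ne_iff.mp (ne_of_sep h₁ h₂')),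
   SplitDepth.weight_eq_half_and_logNorm_eq (finrank_F a c) ⟨𝔭₂, Cor22.mem_placesOver_of_natCast_mem p 𝔭₂ hp₂⟩
    ⟨𝔭₁, Cor22.mem_placesOver_of_natCast_mem p 𝔭₁ hp₁⟩ (Subtype.coe_injective.ne_iff.mp (ne_of_sep h₁ h₂').symm)⟩

/-- `e(𝔭₁|p) = 1`, i.e. `ord_{𝔭₁}(p) = 1`. [cite: DupuyHilado2025, §2.4.2] -/
theorem ord_natCast_prime_eq_one : ord (F a c) 𝔭₁ (p : F a c) = 1 := by
  have hv₁ : 𝔭₁ ∈ placesOver (F a c) p := Cor22.mem_placesOver_of_natCast_mem p 𝔭₁ hp₁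
  rw [Cor22.ord_natCast_eq_ramIdx p 𝔭₁ hv₁]
  have h := (localDegree_pair_eq_one h₁ h₂' hp₁ hp₂).1
  unfold localDegree at h
  have := resDeg_ne_zero (F a c) 𝔭₁
  have hr : ramIdx (F a c) 𝔭₁ = 1 := by
    rcases Nat.eq_zero_or_pos (resDeg (F a c) 𝔭₁) with h0 | h0
    · exact absurd h0 this
    · nlinarith [ramIdx_ne_zero (F a c) 𝔭₁, Nat.pos_of_ne_zero (ramIdx_ne_zero (F a c) 𝔭₁)]
  exact_mod_cast hr

end Pair

/-! ## The point `λ = θ/7^c` of the `λ`-line over `F` -/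

/-- `λ_{a,c} := θ/7^c ∈ F` — a root of `7^c·X² − (2·7^c + 5^a)·X + 5^a`; `λ` and `1 − λ` are `{5,7}`-units (part II).
[cite: MochizukiGenEll2010, Ex 1.3 (ii) p.5] -/
def lam (a c : ℕ) : F a c := θ a c / (7 : F a c) ^ c

/-- `λ' := θ'/7^c`, the conjugate root. [cite: MochizukiGenEll2010, Ex 1.3 (ii) p.5] -/
def lam' (a c : ℕ) : F a c := θ' a c / (7 : F a c) ^ c

/-- `λ + λ' = 2 + 5^a/7^c`. [folklore] -/
theorem lam_add_lam' (a c : ℕ) : lam a c + lam' a c = 2 + (5 : F a c) ^ a / (7 : F a c) ^ c := by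
  have h7 : (7 : F a c) ^ c ≠ 0 := pow_ne_zero _ (by norm_num)
  unfold lam lam'
  rw [← add_div, θ_add_θ']
  unfold s; push_cast
  field_simp

/-- `λ·λ' = 5^a/7^c`. [folklore] -/
theorem lam_mul_lam' (a c : ℕ) : lam a c * lam' a c = (5 : F a c) ^ a / (7 : F a c) ^ c := by
  have h7 : (7 : F a c) ^ c ≠ 0 := pow_ne_zero _ (by norm_num)
  unfold lam lam'
  rw [div_mul_div_comm, θ_mul_θ']
  push_cast
  field_simp

/-- `(1 − λ)(1 − λ') = −1`: `1 − λ` is a unit away from `7`. [folklore] -/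
theorem one_sub_lam_mul (a c : ℕ) : (1 - lam a c) * (1 - lam' a c) = -1 := by
  have h : (1 - lam a c) * (1 - lam' a c) = 1 - (lam a c + lam' a c) + lam a c * lam' a c := by ring
  rw [h, lam_add_lam', lam_mul_lam']; ring

/-- `σ λ = λ'`. [folklore] -/
theorem σ_lam (a c : ℕ) : σ a c (lam a c) = lam' a c := by
  unfold lam lam'
  rw [map_div₀, σ_θ, map_pow, map_ofNat]

/-- The presented point `P_{a,c} = (F_{a,c}, λ_{a,c})` of the `λ`-line. [cite: MochizukiGenEll2010, Ex 1.3 (ii) p.5] -/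
def P (a c : ℕ) : NFPoint := ⟨F a c, lam a c⟩

end Summit.ABC.IUTFork.SUnitFamily

end
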